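import Summits.ResolutionOfSingularities.ResolutionOfSingularities.Theorems.HilbertSamuelEliminationModificationsResolveDenseOpenDim
import Literature.AlgebraicGeometry.Resolution.HilbertSamuelLowerBound
import Literature.AlgebraicGeometry.Resolution.HilbertSamuelRegular
import Literature.AlgebraicGeometry.Resolution.HilbertSamuelIsolatedSingularities
import Literature.AlgebraicGeometry.Resolution.HilbertSamuelLocal
import Literature.AlgebraicGeometry.Resolution.RegularLocusDense
import Literature.AlgebraicGeometry.Resolution.QuasiExcellentSchemesProofs
import Literature.AlgebraicGeometry.Resolution.ResolutionGlue
import Literature.AlgebraicGeometry.Resolution.QuasiExcellentSchemes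
import Literature.AlgebraicGeometry.Resolution.PrincipalizationToResolution
import Mathlib.AlgebraicGeometry.Morphisms.Proper
import Mathlib.AlgebraicGeometry.Noetherian
import HarnessLib

/-!
# `SigmaMaxModifications` (crux stmt-ResolutionOfSingularities-18506, line `Sketch`):
# stub `localWitness_of_resolution` — a resolution of a neighbourhood of `X_max` is a local witness

Stub `localWitness_of_resolution` of the lead skeleton `Sketch` for the crux
`Summit.ResolutionOfSingularities.ResolutionOfSingularities.Theses.HilbertSamuelElimination.SigmaMaxModifications`.

Setting: `X` reduced, of finite type over a field `k`, not regular, `dim X ≤ N`;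
`X_max = Scheme.hsMaxLocus X N` the Hilbert–Samuel locus, `Zc` the open `X ∖ X_max`, and `U₁` an
open neighbourhood on which the only singular points are those of `X_max`
(`U₁ ∩ Sing X ⊆ X_max`). Given a resolution `ρ : Y ⟶ U₁` (proper, birational, `Y` regular) which
is an isomorphism over the open `Reg U₁`, the seven facts making it a LOCAL WITNESS of a
`Σ^max`-modification hold:

* `ρ` is proper (a field of `IsResolution`);
* `Y` is reduced (regular local rings are domains, `Scheme.IsRegular.isReduced`);
* `dim Y ≤ N`: `dim Y ≤ dim U₁` along the birational open
  (`stub_topologicalKrullDim_le_of_isIso_restrict` of the sibling crux `ModificationsResolve`),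
  `dim U₁ ≤ dim X ≤ N`;
* `ρ` is an isomorphism over `W' := U₁ ∩ Zc`: this open of `U₁` lies inside `Reg U₁` by the
  isolation hypothesis (local rings of `U₁` and `X` agree along the open immersion `U₁.ι`,
  `mem_regularLocus_iff_of_flat_of_isPreimmersion`), and `ρ` is an isomorphism over `Reg U₁`
  (`isIso_morphismRestrict_of_le`);
* `ρ⁻¹(W')` is dense in `Y`: `Reg U₁ ⊆ W'` because `X_max ⊆ Sing X` for non-regular `X`
  (`Scheme.hsMaxLocus_subset_compl_regularLocus`), so `W'` is a dense open
  (`Scheme.dense_regularLocus`), and dense opens inside the birational open pull back to dense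
  opens (`dense_preimage_of_isIso_morphismRestrict`);
* `H^N_Y(y) = Φ^{(N)} ≤ H^N_X(ρ y)` (CJS Rem. 2.32: `Scheme.hsFun_of_mem_regularLocus`,
  `Scheme.iterPSum_Phi_le_hsFun`);
* no maximal value `ν` of `Σ_X` is a value of `Σ_Y = {Φ^{(N)}}`: `Φ^{(N)}` is the least element of
  `Σ_X`, so if it were maximal then `Σ_X ⊆ {Φ^{(N)}}` and `X` would be regular
  (`Scheme.isRegular_iff_hsValues_subset`).

Source: V. Cossart, U. Jannsen, S. Saito, *Desingularization: Invariants and Strategy*,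
LNM 2270 (2020), Def. 6.15, Rem. 2.32; V. Cossart, O. Piltant, J. Algebra 529 (2019), Thm. 1.1.
-/

set_option linter.dupNamespace false -- mandated namespace of this single-conjunct summit

noncomputable section

open CategoryTheory AlgebraicGeometry TopologicalSpace
open Literature.AlgebraicGeometry.Resolution Literature.RingTheory.HilbertSamuel

namespace Summit.ResolutionOfSingularities.ResolutionOfSingularities.Theorems.SigmaMaxModifications.Sketch

/-! ## The stub -/

/-- **A resolution of an open neighbourhood `U₁` of `X_max` which is an isomorphism over
`Reg U₁`, when `U₁ ∩ Sing X ⊆ X_max`, is a LOCAL WITNESS of a `Σ^max`-modification.** For `X`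
reduced of finite type over a field `k`, not regular, `dim X ≤ N`, `Zc = X ∖ X_max`
(`X_max = Scheme.hsMaxLocus X N`), an open `U₁ ⊆ X` all of whose points outside `X_max` are
regular points of `X`, and a resolution `ρ : Y ⟶ U₁` (proper, birational, `Y` regular) which is an
isomorphism over an open with underlying set `Reg U₁`: `ρ` is proper, `Y` is reduced of dimension
`≤ N`, `ρ` is an isomorphism over `U₁ ∩ Zc = Reg U₁` with dense preimage, `H^N_Y = Φ^{(N)} ≤ H^N_X`
pointwise (CJS Rem. 2.32), and no maximal value of `Σ_X` is a value of `Σ_Y` (else `Φ^{(N)}`, the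
least element of `Σ_X`, would be maximal and `X` regular).
[cite: CossartJannsenSaito2020, Def. 6.15, Rem. 2.32] [cite: CossartPiltant2019, Thm. 1.1] -/
theorem localWitness_of_resolution :
    ∀ (k : Type) [Field k] (X : Scheme.{0}) (f : X ⟶ Spec (.of k)), LocallyOfFiniteType f →
      QuasiCompact f → IsReduced X → ¬ Scheme.IsRegular X → ∀ N : ℕ,
      topologicalKrullDim X ≤ (N : WithBot ℕ∞) → ∀ (Zc U₁ : X.Opens),
      (Zc : Set X) = (Scheme.hsMaxLocus X N)ᶜ →
      (∀ x : X, x ∈ U₁ → x ∉ Scheme.hsMaxLocus X N → x ∈ Scheme.regularLocus X) →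
      ∀ (Y : Scheme.{0}) (ρ : Y ⟶ (U₁ : Scheme.{0})), IsResolution ρ →
      (∃ V : (U₁ : Scheme.{0}).Opens,
        (V : Set (U₁ : Scheme.{0})) = Scheme.regularLocus (U₁ : Scheme.{0}) ∧ IsIso (ρ ∣_ V)) →
      IsProper ρ ∧ IsReduced Y ∧ topologicalKrullDim Y ≤ (N : WithBot ℕ∞) ∧
        IsIso (ρ ∣_ (U₁.ι ⁻¹ᵁ Zc)) ∧ Dense ((ρ ⁻¹ᵁ (U₁.ι ⁻¹ᵁ Zc) : Y.Opens) : Set Y) ∧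
        (∀ y : Y, Scheme.hsFun Y N y ≤ Scheme.hsFun X N (U₁.ι.base (ρ.base y))) ∧
        ∀ ν : ℕ → ℕ, Maximal (· ∈ Scheme.hsValues X N) ν → ν ∉ Scheme.hsValues Y N := by
  intro k _ X f hft hqc hred hreg N hdim Zc U₁ hZc hisol Y ρ hres hV
  obtain ⟨V, hV, hisoV⟩ := hV
  haveI := hft
  haveI := hqc
  haveI := hred
  -- (1) instances: `X`, `U₁`, `Y` are Noetherian (finite type over `k`; `ρ` is proper)
  haveI : IsNoetherian X := Scheme.isNoetherian_of_finiteType_over_field f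
  haveI : IsProper ρ := hres.isProper
  haveI : IsNoetherian Y := Scheme.isNoetherian_of_finiteType_over_field (ρ ≫ U₁.ι ≫ f)
  -- local rings of `X` have dimension `≤ N`; `X_max ⊆ Sing X`
  have hstalkX : ∀ x : X, ∃ d : ℕ, ringKrullDim (X.presheaf.stalk x) = d ∧ d ≤ N :=
    exists_ringKrullDim_stalk_eq_of_topologicalKrullDim_le hdim
  have hmaxSing : Scheme.hsMaxLocus X N ⊆ (Scheme.regularLocus X)ᶜ :=
    Scheme.hsMaxLocus_subset_compl_regularLocus hstalkX hreg
  -- (2) the open `W' := U₁ ∩ Zc` of `U₁` has underlying set `Reg U₁`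
  have hW'V : U₁.ι ⁻¹ᵁ Zc ≤ V := by
    intro u hu
    have huZ : U₁.ι.base u ∈ (Zc : Set X) := hu
    rw [hZc] at huZ
    have hureg : U₁.ι.base u ∈ Scheme.regularLocus X := hisol _ u.2 huZ
    show u ∈ (V : Set (U₁ : Scheme.{0}))
    rw [hV]
    exact (mem_regularLocus_iff_of_flat_of_isPreimmersion U₁.ι u).mpr hureg
  have hregW' : Scheme.regularLocus (U₁ : Scheme.{0}) ⊆
      ((U₁.ι ⁻¹ᵁ Zc : (U₁ : Scheme.{0}).Opens) : Set (U₁ : Scheme.{0})) := by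
    intro u hu
    show U₁.ι.base u ∈ (Zc : Set X)
    rw [hZc]
    exact fun hmax => hmaxSing hmax ((mem_regularLocus_iff_of_flat_of_isPreimmersion U₁.ι u).mp hu)
  -- (3) dimension: `dim Y ≤ dim U₁ ≤ dim X ≤ N` along the birational open `U₀`
  obtain ⟨U₀, hU₀d, hdU₀, hisoU₀⟩ := hres.isBirational
  haveI := hisoU₀
  have hdimY : topologicalKrullDim Y ≤ (N : WithBot ℕ∞) :=
    le_trans (Summit.ResolutionOfSingularities.ResolutionOfSingularities.Theorems.ModificationsResolve.Sketch.stub_topologicalKrullDim_le_of_isIso_restrict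
      (U₁.ι ≫ f) ρ U₀ hdU₀)
      (le_trans U₁.ι.isOpenEmbedding.isInducing.topologicalKrullDim_le hdim)
  -- (4) every Hilbert–Samuel function of the regular scheme `Y` is `Φ^{(N)}`
  have hstalkY : ∀ y : Y, ∃ d : ℕ, ringKrullDim (Y.presheaf.stalk y) = d ∧ d ≤ N :=
    exists_ringKrullDim_stalk_eq_of_topologicalKrullDim_le hdimY
  have hYval : ∀ y : Y, Scheme.hsFun Y N y = iterPSum N Phi := fun y => by
    obtain ⟨d, hd, hdN⟩ := hstalkY y
    exact Scheme.hsFun_of_mem_regularLocus (hres.isRegular y) hd hdN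
  -- (5) `ρ` is an isomorphism over `W' ≤ V`, with dense preimage
  have hisoW' : IsIso (ρ ∣_ (U₁.ι ⁻¹ᵁ Zc)) := isIso_morphismRestrict_of_le ρ hisoV hW'V
  have hW'd : Dense ((U₁.ι ⁻¹ᵁ Zc : (U₁ : Scheme.{0}).Opens) : Set (U₁ : Scheme.{0})) :=
    (Scheme.dense_regularLocus (U₁ : Scheme.{0})).mono hregW'
  have hdense : Dense ((ρ ⁻¹ᵁ (U₁.ι ⁻¹ᵁ Zc) : Y.Opens) : Set Y) := by
    have h1 : Dense (((U₁.ι ⁻¹ᵁ Zc) ⊓ U₀ : (U₁ : Scheme.{0}).Opens) : Set (U₁ : Scheme.{0})) := by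
      rw [Opens.coe_inf]
      exact hW'd.inter_of_isOpen_left hU₀d (U₁.ι ⁻¹ᵁ Zc).isOpen
    have h2 := dense_preimage_of_isIso_morphismRestrict ρ U₀ hdU₀ h1 inf_le_right
    exact h2.mono fun y hy => (show ρ.base y ∈ (U₁.ι ⁻¹ᵁ Zc) ⊓ U₀ from hy).1
  -- (6), (7) monotonicity and the killing of maximal values
  refine ⟨hres.isProper, hres.isRegular.isReduced, hdimY, hisoW', hdense,
    fun y => ?_, fun ν hν hνY => ?_⟩
  · rw [hYval y]
    exact Scheme.iterPSum_Phi_le_hsFun N _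
  · obtain ⟨y, hy⟩ := hνY
    rw [hYval y] at hy
    subst hy
    refine hreg ((Scheme.isRegular_iff_hsValues_subset hstalkX).mpr fun μ hμ => ?_)
    have h1 : iterPSum N Phi ≤ μ := Scheme.iterPSum_Phi_le_of_mem_hsValues hμ
    exact le_antisymm (hν.2 hμ h1) h1

end Summit.ResolutionOfSingularities.ResolutionOfSingularities.Theorems.SigmaMaxModifications.Sketch

end
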